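import Summits.BirchSwinnertonDyer.BirchSwinnertonDyer.Theorems.ByReductionTypeAtTwoTorsionEulerCharTransport
import HarnessLib

set_option linter.dupNamespace false -- `…BirchSwinnertonDyer.BirchSwinnertonDyer…` is the cell's nested layout (D-0017)
set_option autoImplicit false

/-!
# Greenberg LNM 1716 Lemma 4.7 WITH RATIONAL `p`-TORSION, part 9: THE REVERSE INEQUALITY
# `#ker g₀ · #C_{v₀} ≤ (∏_{v∈S} #𝒦_{v,0}[p^∞]) · #(Sel_∞)_γ` MODULO LEMMA 4.6 ON `Γ`-INVARIANTS

Cell `bsd-2adic` (run/shared/lean/pub/bsd-2adic/), seat `bsd-2adic-tower-1` GEN 32; `--supports stmt-BirchSwinnertonDyer-19271`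
(helper). THEOREMS ONLY (no definition, no named fact, no `sorry`); closes no item; nothing booked; BSD is not proved by any of this.

R. Greenberg, *Iwasawa theory for elliptic curves*, LNM 1716 (1999), §4 Lemma 4.7 (pp. 107–108): `|ker g|·|E(F)_p| =
|ker r|·|(Sel_E(F_∞)_p)_Γ|`. Part 3c of this series (GEN 31, `prod_natCard_mul_natCard_endCoinvariants_le`) proved
`(∏_{v∈S} #𝒦_{v,0}[p^∞])·#(Sel_∞)_γ ≤ #(A₀/Sel₀)·#C` for every receptacle `C` of Cassels' cokernel at an auxiliary place `v₀ ∉ S`,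
WITHOUT Lemma 4.6. THIS FILE proves the REVERSE inequality for the EXACT cokernel
`C_{v₀} = H¹(Γ_{K_{v₀}}, E)(p) / loc_{v₀}(U)` (`U` = the classes of `H¹(Γ_K, E[p^∞])` unramified outside `S ∪ {v₀}` with local class
`0` on `S` and at `∞`), MODULO Greenberg's Lemma 4.6 read on `Γ`-invariants at `v₀` — the displayed hypothesis `h46` of part 7
(every `p`-primary `z ∈ H¹(Γ_{K_{v₀}}, E)` is realised over `K_∞` by a class of `H¹(K_∞, E[p^∞])` Selmer at every place `≠ v₀`
with local class `res z` at every place above `v₀`):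

* `endCoinvariants_mk_eq_of_realizes` — two realisers of the same local class have the same class `[conj_γ T − T] ∈ (Sel_∞)_γ`
  (their difference realises `0`, hence is Selmer: part 7);
* `exists_tMap` — Greenberg's `t : P₀ → (Sel_∞)_γ` as an additive map killing `loc_{v₀}(U)`, whose kernel consists of local
  classes `loc_{v₀} y` of classes `y ∈ Ã` (`Ã` = classes of `H¹(Γ_K, E[p^∞])` Selmer over `K_∞` except above `v₀`; part 7);
* **`natCard_kerG_mul_natCard_cokernel_le`**: `#(A₀/Sel₀) · #C_{v₀} ≤ (∏_{v∈S} #𝒦_{v,0}[p^∞]) · #(Sel_{p^∞}(E/K_∞))_γ`, for every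
  number field `K`, every prime `p`, every `ℤ_p`-extension `κ` with topological generator `γ`, `S ⊇ {bad} ∪ {v ∣ p}` with `𝒦_{v,0}`
  finite on `S`, `v₀ ∉ S`, `(Sel_∞)_γ` and `C_{v₀}` finite — Greenberg's p. 108 run in the tree: `#C_{v₀} ≤ #I·#(Sel_∞)_γ` (`I` =
  image of `Ã`) and `#I·#(A₀/Sel₀) = [Ã : U] ≤ ∏ #𝒦` (part 8).

With part 3c this gives Lemma 4.7 with rational `p`-torsion as the EQUALITY `#(A₀/Sel₀)·#C_{v₀} = ∏#𝒦·#(Sel_∞)_γ` modulo `h46`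
(+ the «DIV» and local-surjectivity inputs of parts 1–3c, tree theorems over `ℚ` at good ordinary / non-split `p`); Thm. 4.1
two-sided (`greenberg_charValue_rankZero` with `E(ℚ)[p] ≠ 0`, the unit form of `X5.O1.TwoAdicEulerCharRankZero W 0` with rational
`2`-torsion) then needs only `h46` and the reverse Cassels count `#E(K)(p) ≤ #C_{v₀}`. HONEST FRAMING: `h46` (Greenberg's Lemma
4.6 on `Γ`-invariants — twists `A_s` + Prop. 4.13, or Λ-adic Poitou–Tate) is NOT proved here; it is the ONE displayed
hypothesis; everything else is kernel-checked. Closes no item; the Birch–Swinnerton-Dyer conjecture is NOT proved by any of this.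

References: [GreenbergLNM1716] §3 Lemmas 3.2–3.3 (pp. 86–87), §4 Lemma 4.6 (pp. 105–107), Lemma 4.7 (pp. 107–108), Prop. 4.13.
-/

noncomputable section

open scoped Classical NumberField

open NumberField IsDedekindDomain Field

namespace Summit.BirchSwinnertonDyer.BirchSwinnertonDyer.Theorems.TorsionEulerChar

open Literature.NumberTheory.EllipticCurves Literature.NumberTheory.GaloisRepresentations
  WeierstrassCurve ZpExtension Literature.NumberTheory.EllipticCurves.IwasawaAlgebra
  Literature.NumberTheory.EllipticCurves.IwasawaDual
  Literature.NumberTheory.EllipticCurves.GreenbergVatsal2000 Literature.NumberTheory.EllipticCurves.GreenbergSelmer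
  Literature.NumberTheory.EllipticCurves.Rank1Residual Summit.BirchSwinnertonDyer.Rank1Residual.X2

variable {K : Type} [Field K] [NumberField K] (W : WeierstrassCurve K) [W.IsElliptic] (p : ℕ) [hp : Fact p.Prime]
  (κ : ZpExtension K p) {γ : absoluteGaloisGroup K}

/-! ## §1 Two realisers of the same class -/

omit [W.IsElliptic] in
/-- **Two realisers of the same local class have the same coinvariant class.** If `T₁, T₂ ∈ H¹(K_∞, E[p^∞])` are Selmer at
every place `≠ v₀` and have the same local class `c` at every place above `v₀`, then `[conj_γ T₁ − T₁] = [conj_γ T₂ − T₂]` in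
`(Sel_∞)_γ = Sel_∞/(conj_γ − 1)Sel_∞`: `T₁ − T₂` realises `0`, hence lies in `Sel_∞` (part 7), and
`(conj_γ T₁ − T₁) − (conj_γ T₂ − T₂) = (conj_γ − 1)(T₁ − T₂)`. [cite: GreenbergLNM1716, §4 Lemma 4.7 (p. 108, the map t)] -/
theorem endCoinvariants_mk_eq_of_realizes (γ : absoluteGaloisGroup K) (v₀ : HeightOneSpectrum (𝓞 K))
    (c : discreteH1 (localSubgroup κ.kerSubgroup (v₀.adicCompletion K)) (localPoints W (v₀.adicCompletion K)))
    (T₁ T₂ : W.subgroupH1 p κ.kerSubgroup)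
    (h1v : ∀ v : HeightOneSpectrum (𝓞 K), v ≠ v₀ → ∀ σ : absoluteGaloisGroup K,
      W.conjH1 p κ.kerSubgroup σ T₁ ∈ W.localKerOver p κ.kerSubgroup (v.adicCompletion K))
    (h1w : ∀ (w : InfinitePlace K) (σ : absoluteGaloisGroup K),
      W.conjH1 p κ.kerSubgroup σ T₁ ∈ W.localKerOver p κ.kerSubgroup w.Completion)
    (h10 : ∀ σ : absoluteGaloisGroup K, W.localResOver p κ.kerSubgroup (v₀.adicCompletion K) (W.conjH1 p κ.kerSubgroup σ T₁) = c)
    (h2v : ∀ v : HeightOneSpectrum (𝓞 K), v ≠ v₀ → ∀ σ : absoluteGaloisGroup K,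
      W.conjH1 p κ.kerSubgroup σ T₂ ∈ W.localKerOver p κ.kerSubgroup (v.adicCompletion K))
    (h2w : ∀ (w : InfinitePlace K) (σ : absoluteGaloisGroup K),
      W.conjH1 p κ.kerSubgroup σ T₂ ∈ W.localKerOver p κ.kerSubgroup w.Completion)
    (h20 : ∀ σ : absoluteGaloisGroup K, W.localResOver p κ.kerSubgroup (v₀.adicCompletion K) (W.conjH1 p κ.kerSubgroup σ T₂) = c)
    (h₁ : W.conjH1 p κ.kerSubgroup γ T₁ - T₁ ∈ W.selmerInfty κ) (h₂ : W.conjH1 p κ.kerSubgroup γ T₂ - T₂ ∈ W.selmerInfty κ) :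
    (QuotientAddGroup.mk (⟨_, h₁⟩ : W.selmerInfty κ) : EndCoinvariants (W.conjSelmerInfty κ γ - 1)) =
      QuotientAddGroup.mk (⟨_, h₂⟩ : W.selmerInfty κ) := by
  have hR : T₁ - T₂ ∈ W.selmerInfty κ := mem_selmerInfty_of_realizes_zero W p κ v₀ (T₁ - T₂)
    (fun v hv σ ↦ by rw [map_sub]; exact sub_mem (h1v v hv σ) (h2v v hv σ))
    (fun w σ ↦ by rw [map_sub]; exact sub_mem (h1w w σ) (h2w w σ))
    (fun σ ↦ by rw [map_sub, map_sub, h10, h20, sub_self])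
  rw [← sub_eq_zero, ← QuotientAddGroup.mk_sub]
  refine (endCoinvariants_mk_eq_zero_iff _ _).mpr ⟨⟨T₁ - T₂, hR⟩, Subtype.ext ?_⟩
  rw [End_sub_apply, AddMonoid.End.one_apply, AddSubgroupClass.coe_sub, coe_conjSelmerInfty_apply,
    AddSubgroupClass.coe_sub]
  change W.conjH1 p κ.kerSubgroup γ (T₁ - T₂) - (T₁ - T₂) =
    (W.conjH1 p κ.kerSubgroup γ T₁ - T₁) - (W.conjH1 p κ.kerSubgroup γ T₂ - T₂)
  rw [map_sub]
  abel

/-! ## §2 Greenberg's map `t : P₀ → (Sel_∞)_γ` modulo `h46` -/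

set_option maxHeartbeats 400000 in
/-- **Greenberg's map `t` modulo Lemma 4.6 on `Γ`-invariants.** For the `ℤ_p`-extension `κ` with topological generator `γ`,
`S ⊇ {bad} ∪ {v ∣ p}`, `v₀ ∉ S`, the subgroup `Ã` of classes of `H¹(Γ_K, E[p^∞])` Selmer over `K_∞` except above `v₀` (given by
membership, `hA`), and GIVEN `h46` (every `p`-primary `z ∈ H¹(Γ_{K_{v₀}}, E)` is realised): there is an additive map
`t : P₀ = H¹(Γ_{K_{v₀}}, E)(p) → (Sel_∞)_γ` (`z ↦ [conj_γ T_z − T_z]`) which (a) kills every `loc_{v₀} u` with `u` of local class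
`0` at every place `≠ v₀` (Cassels' image) and (b) whose kernel consists of local classes `loc_{v₀} y`, `y ∈ Ã` (part 7: Lemma
3.2 + Lemma 3.3 at `v₀`). [cite: GreenbergLNM1716, §4 Lemma 4.7 (p. 108) and Lemma 4.6 (p. 105)] -/
theorem exists_tMap (hγ : κ.IsTopGenerator γ) (S : Finset (HeightOneSpectrum (𝓞 K)))
    (hS : ∀ v ∉ S, ((p : ℕ) : 𝓞 K) ∉ v.asIdeal ∧ W.HasGoodReductionAt v)
    (v₀ : HeightOneSpectrum (𝓞 K)) (hv₀ : v₀ ∉ S)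
    (A : AddSubgroup (W.subgroupH1 p (⊤ : Subgroup (absoluteGaloisGroup K))))
    (hA : ∀ y : W.subgroupH1 p (⊤ : Subgroup (absoluteGaloisGroup K)), y ∈ A ↔
      (∀ v : HeightOneSpectrum (𝓞 K), v ≠ v₀ → ∀ σ : absoluteGaloisGroup K,
        W.conjH1 p κ.kerSubgroup σ (W.resOfLe p (le_top : κ.kerSubgroup ≤ ⊤) y) ∈
          W.localKerOver p κ.kerSubgroup (v.adicCompletion K)) ∧
      ∀ (w : InfinitePlace K) (σ : absoluteGaloisGroup K),
        W.conjH1 p κ.kerSubgroup σ (W.resOfLe p (le_top : κ.kerSubgroup ≤ ⊤) y) ∈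
          W.localKerOver p κ.kerSubgroup w.Completion)
    (h46 : ∀ z : discreteH1 (localSubgroup (⊤ : Subgroup (absoluteGaloisGroup K)) (v₀.adicCompletion K))
        (localPoints W (v₀.adicCompletion K)), (∃ k : ℕ, p ^ k • z = 0) →
      ∃ T : W.subgroupH1 p κ.kerSubgroup,
        (∀ v : HeightOneSpectrum (𝓞 K), v ≠ v₀ → ∀ σ : absoluteGaloisGroup K,
          W.conjH1 p κ.kerSubgroup σ T ∈ W.localKerOver p κ.kerSubgroup (v.adicCompletion K)) ∧
        (∀ (w : InfinitePlace K) (σ : absoluteGaloisGroup K),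
          W.conjH1 p κ.kerSubgroup σ T ∈ W.localKerOver p κ.kerSubgroup w.Completion) ∧
        ∀ σ : absoluteGaloisGroup K,
          W.localResOver p κ.kerSubgroup (v₀.adicCompletion K) (W.conjH1 p κ.kerSubgroup σ T) =
            Literature.NumberTheory.EllipticCurves.resOfLe (localPoints W (v₀.adicCompletion K))
              (Subgroup.comap_mono le_top :
                localSubgroup κ.kerSubgroup (v₀.adicCompletion K) ≤
                  localSubgroup (⊤ : Subgroup (absoluteGaloisGroup K)) (v₀.adicCompletion K)) z) :
    ∃ t : AddCommGroup.primaryComponent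
          (discreteH1 (localSubgroup (⊤ : Subgroup (absoluteGaloisGroup K)) (v₀.adicCompletion K))
            (localPoints W (v₀.adicCompletion K))) p →+ EndCoinvariants (W.conjSelmerInfty κ γ - 1),
      (∀ (z : AddCommGroup.primaryComponent
          (discreteH1 (localSubgroup (⊤ : Subgroup (absoluteGaloisGroup K)) (v₀.adicCompletion K))
            (localPoints W (v₀.adicCompletion K))) p) (u : W.subgroupH1 p (⊤ : Subgroup (absoluteGaloisGroup K))),
        (∀ v : HeightOneSpectrum (𝓞 K), v ≠ v₀ → W.localResOver p ⊤ (v.adicCompletion K) u = 0) →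
        (∀ w : InfinitePlace K, W.localResOver p ⊤ w.Completion u = 0) →
        W.localResOver p ⊤ (v₀.adicCompletion K) u = z → t z = 0) ∧
      ∀ z : AddCommGroup.primaryComponent
          (discreteH1 (localSubgroup (⊤ : Subgroup (absoluteGaloisGroup K)) (v₀.adicCompletion K))
            (localPoints W (v₀.adicCompletion K))) p, t z = 0 →
        ∃ y ∈ A, W.localResOver p ⊤ (v₀.adicCompletion K) y = z := by
  have hpv₀ : ((p : ℕ) : 𝓞 K) ∉ v₀.asIdeal := (hS v₀ hv₀).1
  have hgood₀ : W.HasGoodReductionAt v₀ := (hS v₀ hv₀).2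
  let Pv := discreteH1 (localSubgroup (⊤ : Subgroup (absoluteGaloisGroup K)) (v₀.adicCompletion K))
    (localPoints W (v₀.adicCompletion K))
  let P₀ : AddSubgroup Pv := AddCommGroup.primaryComponent Pv p
  let Sel : AddSubgroup (W.subgroupH1 p κ.kerSubgroup) := W.selmerInfty κ
  have hprim : ∀ z : P₀, ∃ k : ℕ, p ^ k • (z : Pv) = 0 := fun z ↦ by
    obtain ⟨k, hk⟩ := (AddCommGroup.mem_primaryComponent).mp z.2
    exact ⟨k, hk⟩
  -- the realisers `T_z` (choice) and `conj_γ T_z − T_z ∈ Sel_∞`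
  choose Tf hTv hTw hT0 using fun z : P₀ ↦ h46 (z : Pv) (hprim z)
  have hdmem : ∀ z : P₀, W.conjH1 p κ.kerSubgroup γ (Tf z) - Tf z ∈ Sel := fun z ↦
    conjH1_sub_mem_selmerInfty_of_realizes W p κ v₀ (Tf z) _ (hTv z) (hTw z) (hT0 z) γ
  let f : P₀ → EndCoinvariants (W.conjSelmerInfty κ γ - 1) := fun z ↦ QuotientAddGroup.mk (⟨_, hdmem z⟩ : Sel)
  have hf : ∀ z : P₀, f z = QuotientAddGroup.mk (⟨_, hdmem z⟩ : Sel) := fun _ ↦ rfl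
  -- additivity: `T_{z₁+z₂}` and `T_{z₁} + T_{z₂}` both realise `z₁ + z₂`
  have hfadd : ∀ z₁ z₂ : P₀, f (z₁ + z₂) = f z₁ + f z₂ := fun z₁ z₂ ↦ by
    have hsum : W.conjH1 p κ.kerSubgroup γ (Tf z₁ + Tf z₂) - (Tf z₁ + Tf z₂) ∈ Sel := by
      have h : W.conjH1 p κ.kerSubgroup γ (Tf z₁ + Tf z₂) - (Tf z₁ + Tf z₂) =
          (W.conjH1 p κ.kerSubgroup γ (Tf z₁) - Tf z₁) + (W.conjH1 p κ.kerSubgroup γ (Tf z₂) - Tf z₂) := by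
        rw [map_add]; abel
      rw [h]; exact add_mem (hdmem z₁) (hdmem z₂)
    have h := endCoinvariants_mk_eq_of_realizes W p κ γ v₀ _ (Tf (z₁ + z₂)) (Tf z₁ + Tf z₂)
      (hTv _) (hTw _) (hT0 _)
      (fun v hv σ ↦ by rw [map_add]; exact add_mem (hTv z₁ v hv σ) (hTv z₂ v hv σ))
      (fun w σ ↦ by rw [map_add]; exact add_mem (hTw z₁ w σ) (hTw z₂ w σ))
      (fun σ ↦ by rw [map_add, map_add, hT0, hT0, AddSubgroup.coe_add]; exact (map_add _ _ _).symm) (hdmem _) hsum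
    rw [hf, hf, hf, h, ← QuotientAddGroup.mk_add]
    congr 1
    apply Subtype.ext
    change W.conjH1 p κ.kerSubgroup γ (Tf z₁ + Tf z₂) - (Tf z₁ + Tf z₂) =
      (W.conjH1 p κ.kerSubgroup γ (Tf z₁) - Tf z₁) + (W.conjH1 p κ.kerSubgroup γ (Tf z₂) - Tf z₂)
    rw [map_add]; abel
  refine ⟨AddMonoidHom.mk' f hfadd, fun z u huv huw huz ↦ ?_, fun z hz ↦ ?_⟩
  · -- (a) `t(loc_{v₀} u) = 0`: `res u` realises `loc_{v₀} u` with `conj_γ(res u) − res u = 0`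
    obtain ⟨hconj, hv, hw, h0⟩ := resOfLe_top_realizes W p κ v₀ u
      (fun v hv ↦ (W.mem_localKerOver_iff p ⊤ _ u).mpr (huv v hv)) (fun w ↦ (W.mem_localKerOver_iff p ⊤ _ u).mpr (huw w))
    have hzero : W.conjH1 p κ.kerSubgroup γ (W.resOfLe p (le_top : κ.kerSubgroup ≤ ⊤) u) -
        W.resOfLe p (le_top : κ.kerSubgroup ≤ ⊤) u ∈ Sel := by
      rw [hconj γ, sub_self]; exact zero_mem _
    rw [AddMonoidHom.mk'_apply, hf, endCoinvariants_mk_eq_of_realizes W p κ γ v₀ _ (Tf z)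
      (W.resOfLe p (le_top : κ.kerSubgroup ≤ ⊤) u) (hTv z) (hTw z) (hT0 z) hv hw (fun σ ↦ by rw [h0 σ, huz]) (hdmem z) hzero]
    have h0' : (⟨_, hzero⟩ : Sel) = 0 := Subtype.ext (show W.conjH1 p κ.kerSubgroup γ
        (W.resOfLe p (le_top : κ.kerSubgroup ≤ ⊤) u) - W.resOfLe p (le_top : κ.kerSubgroup ≤ ⊤) u =
          ((0 : Sel) : W.subgroupH1 p κ.kerSubgroup) by rw [ZeroMemClass.coe_zero, hconj γ, sub_self])
    rw [h0', QuotientAddGroup.mk_zero]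
  · -- (b) the kernel: `[conj_γ T_z − T_z] = 0` forces `z = loc_{v₀} y` with `y ∈ Ã`
    rw [AddMonoidHom.mk'_apply, hf] at hz
    obtain ⟨s, hs⟩ := (endCoinvariants_mk_eq_zero_iff _ _).mp hz
    have hs' : W.conjH1 p κ.kerSubgroup γ (Tf z) - Tf z =
        W.conjH1 p κ.kerSubgroup γ (s : W.subgroupH1 p κ.kerSubgroup) - s := by
      have h := congrArg (fun x : Sel ↦ (x : W.subgroupH1 p κ.kerSubgroup)) hs
      simp only at h
      rw [End_sub_apply, AddMonoid.End.one_apply, AddSubgroupClass.coe_sub, coe_conjSelmerInfty_apply] at h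
      exact h.symm
    obtain ⟨y, -, hyv, hyw, hyz⟩ := exists_top_of_conjH1_sub_eq W p κ hγ v₀ hpv₀ hgood₀ (z : Pv) (hprim z) (Tf z)
      (hTv z) (hTw z) (hT0 z) s s.2 hs'
    exact ⟨y, (hA y).mpr ⟨hyv, hyw⟩, hyz⟩

/-! ## §3 The reverse inequality -/

/-- **Greenberg LNM 1716 Lemma 4.7 WITH RATIONAL `p`-TORSION — the «`≤`» half, MODULO LEMMA 4.6 ON `Γ`-INVARIANTS.** For
`W/K` elliptic over a number field, the `ℤ_p`-extension `κ` with topological generator `γ`, a finite `S` off which `E` has good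
reduction and `v ∤ p` with `𝒦_{v,0}[p^∞]` finite on `S`, an auxiliary `v₀ ∉ S`, `(Sel_{p^∞}(E/K_∞))_γ` finite and Cassels' cokernel
`C_{v₀} = P₀/(loc_{v₀}(U) ∩ P₀)` finite (`P₀ = H¹(Γ_{K_{v₀}}, E)(p)`, `U` the classes unramified outside `S ∪ {v₀}` with local class
`0` on `S` and at `∞`), GIVEN `h46` (Greenberg's Lemma 4.6 read on the `Γ`-invariant vector supported above `v₀`):
**`#(A₀/Sel₀) · #C_{v₀} ≤ (∏_{v∈S} #𝒦_{v,0}[p^∞]) · #(Sel_∞)_γ`** — `t` of §2 descends to `C_{v₀} → (Sel_∞)_γ` with kernel inside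
the image of `Ã`, so `#C_{v₀} ≤ [Ã : K_η]·#(Sel_∞)_γ`; `K_η ∩ Ã = U + A′`, `[U + A′ : U] = [A′ : U ∩ A′] = #(A₀/Sel₀)` and
`[Ã : U] ≤ ∏ #𝒦` (part 8). [cite: GreenbergLNM1716, §4 Lemma 4.6 (p. 105) and Lemma 4.7 (pp. 107–108)] -/
theorem natCard_kerG_mul_natCard_cokernel_le (hγ : κ.IsTopGenerator γ) (S : Finset (HeightOneSpectrum (𝓞 K)))
    (hS : ∀ v ∉ S, ((p : ℕ) : 𝓞 K) ∉ v.asIdeal ∧ W.HasGoodReductionAt v)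
    (v₀ : HeightOneSpectrum (𝓞 K)) (hv₀ : v₀ ∉ S)
    (hT : ∀ v ∈ S, Finite (W.localTowerKerPrimary κ (v.adicCompletion K) 0))
    [Finite (EndCoinvariants (W.conjSelmerInfty κ γ - 1))]
    [Finite (AddCommGroup.primaryComponent
          (discreteH1 (localSubgroup (⊤ : Subgroup (absoluteGaloisGroup K)) (v₀.adicCompletion K))
            (localPoints W (v₀.adicCompletion K))) p ⧸
        (AddSubgroup.map (W.localResOver p ⊤ (v₀.adicCompletion K))
          (unramifiedOutside (⊤ : Subgroup (absoluteGaloisGroup K)) (W.geomPrimaryTorsion p) p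
              ((↑S : Set (HeightOneSpectrum (𝓞 K))) ∪ {v₀}) ⊓
            (⨅ v ∈ S, W.localKerOver p ⊤ (v.adicCompletion K)) ⊓
            (⨅ w : InfinitePlace K, W.localKerOver p ⊤ w.Completion))).addSubgroupOf
          (AddCommGroup.primaryComponent
            (discreteH1 (localSubgroup (⊤ : Subgroup (absoluteGaloisGroup K)) (v₀.adicCompletion K))
              (localPoints W (v₀.adicCompletion K))) p))]
    (h46 : ∀ z : discreteH1 (localSubgroup (⊤ : Subgroup (absoluteGaloisGroup K)) (v₀.adicCompletion K))
        (localPoints W (v₀.adicCompletion K)), (∃ k : ℕ, p ^ k • z = 0) →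
      ∃ T : W.subgroupH1 p κ.kerSubgroup,
        (∀ v : HeightOneSpectrum (𝓞 K), v ≠ v₀ → ∀ σ : absoluteGaloisGroup K,
          W.conjH1 p κ.kerSubgroup σ T ∈ W.localKerOver p κ.kerSubgroup (v.adicCompletion K)) ∧
        (∀ (w : InfinitePlace K) (σ : absoluteGaloisGroup K),
          W.conjH1 p κ.kerSubgroup σ T ∈ W.localKerOver p κ.kerSubgroup w.Completion) ∧
        ∀ σ : absoluteGaloisGroup K,
          W.localResOver p κ.kerSubgroup (v₀.adicCompletion K) (W.conjH1 p κ.kerSubgroup σ T) =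
            Literature.NumberTheory.EllipticCurves.resOfLe (localPoints W (v₀.adicCompletion K))
              (Subgroup.comap_mono le_top :
                localSubgroup κ.kerSubgroup (v₀.adicCompletion K) ≤
                  localSubgroup (⊤ : Subgroup (absoluteGaloisGroup K)) (v₀.adicCompletion K)) z) :
    Nat.card (W.KerG κ 0) *
        Nat.card (AddCommGroup.primaryComponent
            (discreteH1 (localSubgroup (⊤ : Subgroup (absoluteGaloisGroup K)) (v₀.adicCompletion K))
              (localPoints W (v₀.adicCompletion K))) p ⧸
          (AddSubgroup.map (W.localResOver p ⊤ (v₀.adicCompletion K))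
            (unramifiedOutside (⊤ : Subgroup (absoluteGaloisGroup K)) (W.geomPrimaryTorsion p) p
                ((↑S : Set (HeightOneSpectrum (𝓞 K))) ∪ {v₀}) ⊓
              (⨅ v ∈ S, W.localKerOver p ⊤ (v.adicCompletion K)) ⊓
              (⨅ w : InfinitePlace K, W.localKerOver p ⊤ w.Completion))).addSubgroupOf
            (AddCommGroup.primaryComponent
              (discreteH1 (localSubgroup (⊤ : Subgroup (absoluteGaloisGroup K)) (v₀.adicCompletion K))
                (localPoints W (v₀.adicCompletion K))) p)) ≤
      (∏ v ∈ S, Nat.card (W.localTowerKerPrimary κ (v.adicCompletion K) 0)) *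
        Nat.card (EndCoinvariants (W.conjSelmerInfty κ γ - 1)) := by
  -- notation
  let Pv := discreteH1 (localSubgroup (⊤ : Subgroup (absoluteGaloisGroup K)) (v₀.adicCompletion K))
    (localPoints W (v₀.adicCompletion K))
  let P₀ : AddSubgroup Pv := AddCommGroup.primaryComponent Pv p
  let loc : W.subgroupH1 p (⊤ : Subgroup (absoluteGaloisGroup K)) →+ Pv := W.localResOver p ⊤ (v₀.adicCompletion K)
  set U : AddSubgroup (W.subgroupH1 p (⊤ : Subgroup (absoluteGaloisGroup K))) :=
    unramifiedOutside (⊤ : Subgroup (absoluteGaloisGroup K)) (W.geomPrimaryTorsion p) p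
        ((↑S : Set (HeightOneSpectrum (𝓞 K))) ∪ {v₀}) ⊓
      (⨅ v ∈ S, W.localKerOver p ⊤ (v.adicCompletion K)) ⊓
      (⨅ w : InfinitePlace K, W.localKerOver p ⊤ w.Completion) with hUdef
  let L : AddSubgroup Pv := U.map loc
  let LP : AddSubgroup P₀ := L.addSubgroupOf P₀
  have hU : ∀ u, u ∈ U ↔ (∀ v : HeightOneSpectrum (𝓞 K), v ≠ v₀ → W.localResOver p ⊤ (v.adicCompletion K) u = 0) ∧
      ∀ w : InfinitePlace K, W.localResOver p ⊤ w.Completion u = 0 :=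
    fun u ↦ mem_receptacleClasses_iff W p S hS v₀ hv₀ u
  -- `Ã` (sealed)
  obtain ⟨A, hA⟩ : ∃ A : AddSubgroup (W.subgroupH1 p (⊤ : Subgroup (absoluteGaloisGroup K))), ∀ y, y ∈ A ↔
      (∀ v : HeightOneSpectrum (𝓞 K), v ≠ v₀ → ∀ σ : absoluteGaloisGroup K,
        W.conjH1 p κ.kerSubgroup σ (W.resOfLe p (le_top : κ.kerSubgroup ≤ ⊤) y) ∈
          W.localKerOver p κ.kerSubgroup (v.adicCompletion K)) ∧
      ∀ (w : InfinitePlace K) (σ : absoluteGaloisGroup K),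
        W.conjH1 p κ.kerSubgroup σ (W.resOfLe p (le_top : κ.kerSubgroup ≤ ⊤) y) ∈ W.localKerOver p κ.kerSubgroup w.Completion :=
    ⟨((⨅ (v : HeightOneSpectrum (𝓞 K)) (_ : v ≠ v₀) (σ : absoluteGaloisGroup K),
        (W.localKerOver p κ.kerSubgroup (v.adicCompletion K)).comap
          ((W.conjH1 p κ.kerSubgroup σ).comp (W.resOfLe p (le_top : κ.kerSubgroup ≤ ⊤)))) ⊓
      (⨅ (w : InfinitePlace K) (σ : absoluteGaloisGroup K),
        (W.localKerOver p κ.kerSubgroup w.Completion).comap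
          ((W.conjH1 p κ.kerSubgroup σ).comp (W.resOfLe p (le_top : κ.kerSubgroup ≤ ⊤))))),
      fun y ↦ by
        simp only [AddSubgroup.mem_inf, AddSubgroup.mem_iInf, AddSubgroup.mem_comap, AddMonoidHom.coe_comp,
          Function.comp_apply]⟩
  have hUA : U ≤ A := fun u hu ↦ by
    obtain ⟨hfin, hinf⟩ := (hU u).mp hu
    obtain ⟨-, hv, hw, -⟩ := resOfLe_top_realizes W p κ v₀ u
      (fun v hv ↦ (W.mem_localKerOver_iff p ⊤ _ u).mpr (hfin v hv)) (fun w ↦ (W.mem_localKerOver_iff p ⊤ _ u).mpr (hinf w))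
    exact (hA u).mpr ⟨hv, hw⟩
  have hlocP : ∀ y : W.subgroupH1 p (⊤ : Subgroup (absoluteGaloisGroup K)), loc y ∈ P₀ := fun y ↦ by
    obtain ⟨k, hk⟩ := SignedEC.H1SigmaCorank.exists_pow_smul_eq_zero_subgroupH1_top W p y
    exact (AddCommGroup.mem_primaryComponent).mpr ⟨k, by rw [← map_nsmul, hk, map_zero]⟩
  let locP : W.subgroupH1 p (⊤ : Subgroup (absoluteGaloisGroup K)) →+ P₀ := loc.codRestrict P₀ hlocP
  -- Greenberg's `t`, descended to `C_{v₀} = P₀/LP`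
  obtain ⟨t₀, hkill, hker⟩ := exists_tMap W p κ hγ S hS v₀ hv₀ A hA h46
  have hLP : LP ≤ t₀.ker := fun z hz ↦ by
    obtain ⟨u, hu, huz⟩ := (AddSubgroup.mem_addSubgroupOf).mp hz
    obtain ⟨hfin, hinf⟩ := (hU u).mp hu
    exact hkill z u hfin hinf huz
  let t : (P₀ ⧸ LP) →+ EndCoinvariants (W.conjSelmerInfty κ γ - 1) := QuotientAddGroup.lift LP t₀ hLP
  let η : A →+ (P₀ ⧸ LP) := (QuotientAddGroup.mk' LP).comp (locP.comp A.subtype)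
  have hker_le : t.ker ≤ η.range := by
    intro q hq
    induction q using QuotientAddGroup.induction_on with
    | H z =>
      rw [AddMonoidHom.mem_ker, QuotientAddGroup.lift_mk] at hq
      obtain ⟨y, hyA, hyz⟩ := hker z hq
      exact ⟨⟨y, hyA⟩, by
        change QuotientAddGroup.mk' LP (locP y) = QuotientAddGroup.mk z
        rw [QuotientAddGroup.mk'_apply]
        exact congrArg _ (Subtype.ext hyz)⟩
  -- counting
  have hQ : Nat.card (P₀ ⧸ LP) = Nat.card ((P₀ ⧸ LP) ⧸ t.ker) * Nat.card t.ker :=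
    AddSubgroup.card_eq_card_quotient_mul_card_addSubgroup t.ker
  have hrange : Nat.card ((P₀ ⧸ LP) ⧸ t.ker) ≤ Nat.card (EndCoinvariants (W.conjSelmerInfty κ γ - 1)) := by
    rw [Nat.card_congr (QuotientAddGroup.quotientKerEquivRange t).toEquiv]
    exact AddSubgroup.card_le_card_addGroup t.range
  have hkerI : Nat.card t.ker ≤ Nat.card η.range := AddSubgroup.card_le_of_le hker_le
  let Kη : AddSubgroup (W.subgroupH1 p (⊤ : Subgroup (absoluteGaloisGroup K))) := AddSubgroup.comap locP LP
  have hηker : η.ker = Kη.addSubgroupOf A := by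
    ext y
    rw [AddMonoidHom.mem_ker, AddSubgroup.mem_addSubgroupOf, AddSubgroup.mem_comap]
    change QuotientAddGroup.mk' LP (locP y) = 0 ↔ _
    rw [QuotientAddGroup.mk'_apply, QuotientAddGroup.eq_zero_iff]
  have hI : Nat.card η.range = Kη.relIndex A := by
    rw [AddSubgroup.relIndex, ← hηker]
    exact (AddSubgroup.index_ker η).symm
  let A' : AddSubgroup (W.subgroupH1 p (⊤ : Subgroup (absoluteGaloisGroup K))) := A ⊓ loc.ker
  have hKη : Kη ⊓ A = U ⊔ A' := by
    apply le_antisymm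
    · intro y hy
      obtain ⟨hyK, hyA⟩ := AddSubgroup.mem_inf.mp hy
      obtain ⟨u, hu, huy⟩ := (AddSubgroup.mem_addSubgroupOf).mp (AddSubgroup.mem_comap.mp hyK)
      refine AddSubgroup.mem_sup.mpr ⟨u, hu, y - u, AddSubgroup.mem_inf.mpr ⟨sub_mem hyA (hUA hu), ?_⟩, add_sub_cancel u y⟩
      rw [AddMonoidHom.mem_ker, map_sub, sub_eq_zero]
      exact huy.symm
    · refine sup_le (fun u hu ↦ AddSubgroup.mem_inf.mpr ⟨?_, hUA hu⟩)
        (fun y hy ↦ AddSubgroup.mem_inf.mpr ⟨?_, (AddSubgroup.mem_inf.mp hy).1⟩)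
      · exact AddSubgroup.mem_comap.mpr ((AddSubgroup.mem_addSubgroupOf).mpr ⟨u, hu, rfl⟩)
      · refine AddSubgroup.mem_comap.mpr ((AddSubgroup.mem_addSubgroupOf).mpr ⟨0, zero_mem _, ?_⟩)
        rw [map_zero]
        exact ((AddMonoidHom.mem_ker).mp (AddSubgroup.mem_inf.mp hy).2).symm
  have hA'U : U.relIndex A' = Nat.card (W.KerG κ 0) := (natCard_kerG_eq_relIndex W p κ S hS v₀ hv₀ A hA).symm
  obtain ⟨hUAle, -⟩ := relIndex_le_prod_natCard_localTowerKerPrimary W p κ S hS v₀ hv₀ hT A hA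
  have hsplit : U.relIndex A = Nat.card (W.KerG κ 0) * Kη.relIndex A := by
    rw [← AddSubgroup.inf_relIndex_right Kη A, hKη,
      ← AddSubgroup.relIndex_mul_relIndex U (U ⊔ A') A le_sup_left (sup_le hUA inf_le_left),
      AddSubgroup.relIndex_sup_left, hA'U]
  calc Nat.card (W.KerG κ 0) * Nat.card (P₀ ⧸ LP)
      = Nat.card (W.KerG κ 0) * (Nat.card ((P₀ ⧸ LP) ⧸ t.ker) * Nat.card t.ker) := by rw [hQ]
    _ ≤ Nat.card (W.KerG κ 0) * (Nat.card (EndCoinvariants (W.conjSelmerInfty κ γ - 1)) * Kη.relIndex A) :=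
        Nat.mul_le_mul_left _ (Nat.mul_le_mul hrange (hkerI.trans (le_of_eq hI)))
    _ = U.relIndex A * Nat.card (EndCoinvariants (W.conjSelmerInfty κ γ - 1)) := by rw [hsplit]; ring
    _ ≤ (∏ v ∈ S, Nat.card (W.localTowerKerPrimary κ (v.adicCompletion K) 0)) *
          Nat.card (EndCoinvariants (W.conjSelmerInfty κ γ - 1)) := Nat.mul_le_mul_right _ hUAle

end Summit.BirchSwinnertonDyer.BirchSwinnertonDyer.Theorems.TorsionEulerChar

end
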